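import Mathlib.Topology.Algebra.Group.ClosedSubgroup
import Literature.AnabelianGeometry.SemiGraphs.PSCFundamentalGroup
import HarnessLib

/-!
# The finite étale `Π_G`-covering datum `G_U` of a PSC datum ([CombGC] Def. 1.1 (ii))

Mochizuki, *A combinatorial version of the Grothendieck conjecture*, Tohoku Math. J. **59** (2007),
Def. 1.1 (ii), author's ms p. 6: "We shall refer to a finite étale covering of `G` that arises from
an open subgroup of `Π_G` as a [finite étale] `Π_G`-covering of `G`"; §1 repeatedly "replaces `G` by
a finite étale `Π_G`-covering" (Prop. 1.2, Prop. 1.5 (i), Thm. 1.6 (i)(ii), [IUTchI] Rmk. 1.2.3 (iv))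
[cite: MochizukiCombGC2007, Def 1.1(ii) p.6].  `PSCFundamentalGroup.lean` already READS the cusps /
nodes / vertices of `G_U` (`U ⊆ Π_G` open) as the double cosets `U \ Π_G / Π_c` (`/ Π_e`, `/ Π_v`)
and its verticial (…) subgroups as the `U ∩ γ Π_v γ⁻¹`; this file turns that reading into the DATUM
`PSCDatum.restrict G U hU : PSCDatum ↥U` for `U` open of finite index (abc-iut GAP-LEDGER row
G-w4d052-1, "(F1)"):
* underlying semi-graph `restrictGraph`: vertices `Σ v, Fin #(U\Π/Π_v)`, nodes `Σ e, Fin #(U\Π/Π_e)`,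
  cusps `Σ c, Fin #(U\Π/Π_c)` — the finite double-coset spaces ENUMERATED by `Finite.equivFin`, so
  the graph lives in `Type` whatever the universe of `Π` (no `Shrink`);
* representative subgroups `U ∩ y Π_v y⁻¹` (`y = vrep w` the chosen representative of the double
  coset), likewise for nodes and cusps; `Σ` unchanged; `U` is pro-`Σ` (`isProSigma_subgroup`);
* coincidence maps: the cusp `U x Π_c` abuts to the vertex `U x g⁻¹ Π_v`, `g Π_c g⁻¹ ⊆ Π_v` the
  chosen branch conjugator `cuspConj` of `G` (`x Π_c x⁻¹ ⊆ (x g⁻¹) Π_v (x g⁻¹)⁻¹`); likewise for the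
  two branches of a node (`nodeConjFst/Snd`).  For geometric data the double coset `U x g⁻¹ Π_v`
  does not depend on the choice of `g` (a cuspidal subgroup lies in a unique verticial subgroup);
* genus of `w = U y Π_v` over `v` by Riemann–Hurwitz for the (tamely ramified, by `p ∉ Σ`)
  covering of normalisations of components underlying an admissible covering:
  `2 g_w − 2 + b_w = d_w (2 g_v − 2 + b_v)`, `d_w = [y Π_v y⁻¹ : U ∩ y Π_v y⁻¹]`, `b` = number of
  branches at the vertex (`hurwitzGenus`, `PSCSemiGraph.branchCount`).  HONEST NOTE: for data of
  geometric origin this IS the genus of the component; over arbitrary interface data it is a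
  definition, as is every field of `PSCDatum`.
Definitions and defining equations only (review lane); transfer lemmas (verticial / edge-like
subgroups of `G_U` vs `IsVerticialIn U`, sub-covering counts, functoriality) go to proof
companions.  Nothing here asserts anything about pointed stable curves; no statement takes a side
on [IUTchIII] Cor. 3.12.
-/

namespace Literature.AnabelianGeometry.SemiGraphs

open scoped Pointwise

universe u

/-! ### Enumerated double cosets `U \ Π / K` for `U` of finite index -/

namespace PSCCovering

variable {P : Type u} [Group P] (U K : Subgroup P)

/-- `U \ Π / K` is finite when `U` has finite index (a quotient of `U \ Π`). [cite: MochizukiCombGC2007, Def 1.1(ii) p.6] -/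
theorem finite_doubleCosetQuotient [U.FiniteIndex] :
    Finite (DoubleCoset.Quotient (U : Set P) (K : Set P)) := by
  classical
  let f : P ⧸ U → DoubleCoset.Quotient (U : Set P) (K : Set P) :=
    Quotient.lift (fun x : P => DoubleCoset.mk U K x⁻¹) (by
      intro x y hxy
      have hxy' : x⁻¹ * y ∈ U := QuotientGroup.leftRel_apply.mp hxy
      show DoubleCoset.mk U K x⁻¹ = DoubleCoset.mk U K y⁻¹
      rw [DoubleCoset.eq]
      exact ⟨(x⁻¹ * y)⁻¹, U.inv_mem hxy', 1, K.one_mem, by simp⟩)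
  refine Finite.of_surjective f fun q => ?_
  induction q using Quotient.inductionOn with
  | h x => exact ⟨QuotientGroup.mk x⁻¹, by simp [f]⟩

/-- The index type `Fin #(U \ Π / K)` of the enumerated double cosets.
[cite: MochizukiCombGC2007, Def 1.1(ii) p.6] -/
abbrev dcFin : Type := Fin (Nat.card (DoubleCoset.Quotient (U : Set P) (K : Set P)))

/-- The enumeration `U \ Π / K ≃ Fin #(U \ Π / K)` (a fixed choice). [cite: MochizukiCombGC2007, Def 1.1(ii) p.6] -/
noncomputable def dcEnum [U.FiniteIndex] : DoubleCoset.Quotient (U : Set P) (K : Set P) ≃ dcFin U K :=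
  haveI := finite_doubleCosetQuotient U K
  Finite.equivFin _

/-- A representative `x_i ∈ Π` of the `i`-th double coset `U x_i K`. [cite: MochizukiCombGC2007, Def 1.1(ii) p.6] -/
noncomputable def dcRep [U.FiniteIndex] (i : dcFin U K) : P := ((dcEnum U K).symm i).out

/-- The index of the double coset `U x K` of `x`. [cite: MochizukiCombGC2007, Def 1.1(ii) p.6] -/
noncomputable def dcIdx [U.FiniteIndex] (x : P) : dcFin U K := dcEnum U K (DoubleCoset.mk U K x)

variable [U.FiniteIndex]

/-- `dcIdx (dcRep i) = i`. [cite: MochizukiCombGC2007, Def 1.1(ii) p.6] -/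
@[simp] theorem dcIdx_dcRep (i : dcFin U K) : dcIdx U K (dcRep U K i) = i := by
  unfold dcIdx dcRep
  rw [DoubleCoset.out_eq', Equiv.apply_symm_apply]

/-- Same index iff same double coset. [cite: MochizukiCombGC2007, Def 1.1(ii) p.6] -/
theorem dcIdx_eq_iff {x y : P} : dcIdx U K x = dcIdx U K y ↔ ∃ u ∈ U, ∃ k ∈ K, y = u * x * k := by
  unfold dcIdx
  rw [(dcEnum U K).apply_eq_iff_eq, DoubleCoset.eq]

/-- The representative of the double coset of `x` is `u * x * k`, `u ∈ U`, `k ∈ K`. [cite: MochizukiCombGC2007, Def 1.1(ii) p.6] -/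
theorem exists_dcRep_dcIdx_eq (x : P) : ∃ u ∈ U, ∃ k ∈ K, dcRep U K (dcIdx U K x) = u * x * k := by
  rw [← dcIdx_eq_iff U K, dcIdx_dcRep]

end PSCCovering

/-! ### Branch counts and the Riemann–Hurwitz genus -/

namespace PSCSemiGraph

/-- The number of branches of `𝔾` at the vertex `v`: cusps at `v` plus node-branches at `v` (a node
joining `v` to itself contributes both branches) = the number of special points on the normalisation
of the irreducible component `v`. [cite: MochizukiCombGC2007, Def 1.1(i) p.6] -/
def branchCount (𝔾 : PSCSemiGraph) (v : 𝔾.V) : ℕ :=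
  (Finset.univ.filter fun c : 𝔾.C => 𝔾.cuspEnd c = v).card +
    ∑ e : 𝔾.N, (if 𝔾.nodeEnds e = s(v, v) then 2 else if v ∈ 𝔾.nodeEnds e then 1 else 0)

end PSCSemiGraph

/-- The Riemann–Hurwitz genus of a connected degree-`d` covering `w → v` of smooth proper curves,
`v` of genus `gv`, tamely ramified and étale away from `bv` points of `v` over which lie exactly
`bw` points of `w`: `2 gw − 2 + bw = d (2 gv − 2 + bv)`, i.e. `gw = 1 + (d (2 gv − 2 + bv) − bw) / 2`
(integer arithmetic, truncated at `0`; exact for the components of an admissible covering of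
pointed stable curves, [CombGC] Def. 1.1 (i)). [cite: MochizukiCombGC2007, Def 1.1(i) p.6] -/
def hurwitzGenus (d gv bv bw : ℕ) : ℕ :=
  Int.toNat (1 + ((d : ℤ) * (2 * (gv : ℤ) - 2 + bv) - bw) / 2)

namespace PSCDatum

variable {P : Type u} [Group P] [TopologicalSpace P] (G : PSCDatum P)

/-! ### Chosen branch data of `G` (the conjugators of `nodeGp_le` / `cuspGp_le`) -/

/-- A chosen conjugator `γ_c` of the verticial branch of the cusp `c`: `γ_c Π_c γ_c⁻¹ ⊆ Π_{v(c)}`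
(Def. 1.1: the morphism `G_c → G_{v(c)}`). [cite: MochizukiCombGC2007, Def 1.1(ii) p.6] -/
noncomputable def cuspConj (c : G.graph.C) : ConjAct P := Classical.choose (G.cuspGp_le c)

/-- `γ_c • Π_c ≤ Π_{v(c)}`. [cite: MochizukiCombGC2007, Def 1.1(ii) p.6] -/
theorem cuspConj_smul_le (c : G.graph.C) : G.cuspConj c • G.cuspGp c ≤ G.vertGp (G.graph.cuspEnd c) :=
  Classical.choose_spec (G.cuspGp_le c)

/-- The (chosen) first end vertex of the node `e`. [cite: MochizukiCombGC2007, Def 1.1(ii) p.6] -/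
noncomputable def nodeFst (e : G.graph.N) : G.graph.V := Classical.choose (G.nodeGp_le e)

/-- The (chosen) second end vertex of the node `e`. [cite: MochizukiCombGC2007, Def 1.1(ii) p.6] -/
noncomputable def nodeSnd (e : G.graph.N) : G.graph.V :=
  Classical.choose (Classical.choose_spec (G.nodeGp_le e))

/-- `nodeEnds e = s(nodeFst e, nodeSnd e)`. [cite: MochizukiCombGC2007, Def 1.1(ii) p.6] -/
theorem nodeEnds_eq (e : G.graph.N) : G.graph.nodeEnds e = s(G.nodeFst e, G.nodeSnd e) :=
  (Classical.choose_spec (Classical.choose_spec (G.nodeGp_le e))).1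

/-- A chosen conjugator of the first branch of the node `e`: `γ • Π_e ≤ Π_{nodeFst e}`.
[cite: MochizukiCombGC2007, Def 1.1(ii) p.6] -/
noncomputable def nodeConjFst (e : G.graph.N) : ConjAct P :=
  Classical.choose (Classical.choose_spec (Classical.choose_spec (G.nodeGp_le e))).2.1

/-- `nodeConjFst e • Π_e ≤ Π_{nodeFst e}`. [cite: MochizukiCombGC2007, Def 1.1(ii) p.6] -/
theorem nodeConjFst_smul_le (e : G.graph.N) : G.nodeConjFst e • G.nodeGp e ≤ G.vertGp (G.nodeFst e) :=
  Classical.choose_spec (Classical.choose_spec (Classical.choose_spec (G.nodeGp_le e))).2.1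

/-- A chosen conjugator of the second branch of the node `e`: `γ • Π_e ≤ Π_{nodeSnd e}`.
[cite: MochizukiCombGC2007, Def 1.1(ii) p.6] -/
noncomputable def nodeConjSnd (e : G.graph.N) : ConjAct P :=
  Classical.choose (Classical.choose_spec (Classical.choose_spec (G.nodeGp_le e))).2.2

/-- `nodeConjSnd e • Π_e ≤ Π_{nodeSnd e}`. [cite: MochizukiCombGC2007, Def 1.1(ii) p.6] -/
theorem nodeConjSnd_smul_le (e : G.graph.N) : G.nodeConjSnd e • G.nodeGp e ≤ G.vertGp (G.nodeSnd e) :=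
  Classical.choose_spec (Classical.choose_spec (Classical.choose_spec (G.nodeGp_le e))).2.2

/-! ### The covering datum `G_U` -/

section Restrict

open PSCCovering

variable (U : Subgroup P) [U.FiniteIndex]

/-- Representative `y ∈ Π` of the vertex `w = (v, j)` of `G_U` (the `j`-th double coset is `U y Π_v`).
[cite: MochizukiCombGC2007, Def 1.1(ii) p.6] -/
noncomputable def vrep (w : Σ v : G.graph.V, dcFin U (G.vertGp v)) : P := dcRep U (G.vertGp w.1) w.2

/-- Representative `x ∈ Π` of the node `(e, i)` of `G_U` (double coset `U x Π_e`).
[cite: MochizukiCombGC2007, Def 1.1(ii) p.6] -/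
noncomputable def nrep (d : Σ e : G.graph.N, dcFin U (G.nodeGp e)) : P := dcRep U (G.nodeGp d.1) d.2

/-- Representative `x ∈ Π` of the cusp `(c, i)` of `G_U` (double coset `U x Π_c`).
[cite: MochizukiCombGC2007, Def 1.1(ii) p.6] -/
noncomputable def crep (d : Σ c : G.graph.C, dcFin U (G.cuspGp c)) : P := dcRep U (G.cuspGp d.1) d.2

/-- The vertex of `G_U` over `v` through which the element `x ∈ Π` passes: the double coset
`U x Π_v`. [cite: MochizukiCombGC2007, Def 1.1(ii) p.6] -/
noncomputable def vertexOver (v : G.graph.V) (x : P) : Σ v : G.graph.V, dcFin U (G.vertGp v) :=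
  ⟨v, dcIdx U (G.vertGp v) x⟩

/-- **The underlying semi-graph of the `Π_G`-covering `G_U`** (`U ⊆ Π_G` of finite index):
vertices over `v` = `U \ Π_G / Π_v`, nodes over `e` = `U \ Π_G / Π_e`, cusps over `c` =
`U \ Π_G / Π_c` (enumerated); the cusp `U x Π_c` abuts to the vertex `U x γ_c⁻¹ Π_{v(c)}`, the node
`U x Π_e` to the vertices `U x γ₁⁻¹ Π_{v₁}`, `U x γ₂⁻¹ Π_{v₂}` given by the two branch inclusions
`γ_i Π_e γ_i⁻¹ ⊆ Π_{v_i}` of `G`. [cite: MochizukiCombGC2007, Def 1.1(ii) p.6] -/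
noncomputable def restrictGraph : PSCSemiGraph where
  V := Σ v : G.graph.V, dcFin U (G.vertGp v)
  N := Σ e : G.graph.N, dcFin U (G.nodeGp e)
  C := Σ c : G.graph.C, dcFin U (G.cuspGp c)
  nodeEnds d :=
    s(G.vertexOver U (G.nodeFst d.1) (G.nrep U d * (ConjAct.ofConjAct (G.nodeConjFst d.1))⁻¹),
      G.vertexOver U (G.nodeSnd d.1) (G.nrep U d * (ConjAct.ofConjAct (G.nodeConjSnd d.1))⁻¹))
  cuspEnd d :=
    G.vertexOver U (G.graph.cuspEnd d.1) (G.crep U d * (ConjAct.ofConjAct (G.cuspConj d.1))⁻¹)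

/-- The representative verticial subgroup of `Π_{G_U} = U` at the vertex `w = U y Π_v`:
`U ∩ y Π_v y⁻¹`, as a subgroup of `U`. [cite: MochizukiCombGC2007, Def 1.1(ii) p.6] -/
noncomputable def restrictVertGp (w : (G.restrictGraph U).V) : Subgroup U :=
  (ConjAct.toConjAct (G.vrep U w) • G.vertGp w.1).subgroupOf U

/-- The representative nodal subgroup of `Π_{G_U} = U` at the node `U x Π_e`: `U ∩ x Π_e x⁻¹`.
[cite: MochizukiCombGC2007, Def 1.1(ii) p.7] -/
noncomputable def restrictNodeGp (d : (G.restrictGraph U).N) : Subgroup U :=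
  (ConjAct.toConjAct (G.nrep U d) • G.nodeGp d.1).subgroupOf U

/-- The representative cuspidal subgroup of `Π_{G_U} = U` at the cusp `U x Π_c`: `U ∩ x Π_c x⁻¹`.
[cite: MochizukiCombGC2007, Def 1.1(ii) p.7] -/
noncomputable def restrictCuspGp (d : (G.restrictGraph U).C) : Subgroup U :=
  (ConjAct.toConjAct (G.crep U d) • G.cuspGp d.1).subgroupOf U

/-- The local degree of `G_U → G` at the vertex `w = U y Π_v` over `v`:
`d_w = [y Π_v y⁻¹ : U ∩ y Π_v y⁻¹]` (the number of sheets of the component `w` over the component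
`v`). [cite: MochizukiCombGC2007, Def 1.1(ii) p.6] -/
noncomputable def localDegree (w : (G.restrictGraph U).V) : ℕ :=
  U.relIndex (ConjAct.toConjAct (G.vrep U w) • G.vertGp w.1)

/-- The genus of the vertex `w` of `G_U` over `v`, by Riemann–Hurwitz for the covering of
normalisations of components (see `hurwitzGenus`; exact for data of geometric origin, a
definition otherwise). [cite: MochizukiCombGC2007, Rmk 1.1.5 p.8] -/
noncomputable def restrictGenus (w : (G.restrictGraph U).V) : ℕ :=
  hurwitzGenus (G.localDegree U w) (G.genus w.1) (G.graph.branchCount w.1)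
    ((G.restrictGraph U).branchCount w)

variable {G U} in
omit [U.FiniteIndex] in
/-- A conjugate of a closed subgroup is closed. [cite: MochizukiCombGC2007, Def 1.1(ii) p.6] -/
private theorem isClosed_conj [IsTopologicalGroup P] {A : Subgroup P} (hA : IsClosed (A : Set P))
    (x : P) : IsClosed ((ConjAct.toConjAct x • A : Subgroup P) : Set P) := by
  have h : ((ConjAct.toConjAct x • A : Subgroup P) : Set P) =
      (fun a : P => x⁻¹ * a * x⁻¹⁻¹) ⁻¹' (A : Set P) := by
    ext a
    rw [SetLike.mem_coe, Subgroup.mem_pointwise_smul_iff_inv_smul_mem, ← ConjAct.toConjAct_inv,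
      ConjAct.smul_def, ConjAct.ofConjAct_toConjAct]
    rfl
  rw [h]
  exact hA.preimage (by fun_prop)

variable {G U} in
omit [U.FiniteIndex] in
/-- The trace on `U` of a closed subgroup is closed in `U`. [cite: MochizukiCombGC2007, Def 1.1(ii) p.6] -/
private theorem isClosed_subgroupOf {A : Subgroup P} (hA : IsClosed (A : Set P)) :
    IsClosed ((A.subgroupOf U : Subgroup U) : Set U) :=
  hA.preimage continuous_subtype_val

variable {U} in
omit [TopologicalSpace P] [U.FiniteIndex] in
/-- Conjugating the trace `U ∩ A` by `u ∈ U` inside `U` is the trace of the conjugate `u A u⁻¹`.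
[cite: MochizukiCombGC2007, Def 1.1(ii) p.6] -/
theorem conj_subgroupOf_eq (A : Subgroup P) (u : U) :
    ConjAct.toConjAct u • A.subgroupOf U = (ConjAct.toConjAct (u : P) • A).subgroupOf U := by
  ext a
  simp only [Subgroup.mem_pointwise_smul_iff_inv_smul_mem, Subgroup.mem_subgroupOf,
    ← ConjAct.toConjAct_inv, ConjAct.smul_def, ConjAct.ofConjAct_toConjAct, Subgroup.coe_mul,
    Subgroup.coe_inv]

variable {G U} in
omit [TopologicalSpace P] [U.FiniteIndex] in
/-- `k Π_v k⁻¹ = Π_v` for `k ∈ Π_v`. [cite: MochizukiCombGC2007, Def 1.1(ii) p.6] -/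
private theorem conj_smul_eq_self_of_mem {V : Subgroup P} {k : P} (hk : k ∈ V) :
    ConjAct.toConjAct k • V = V := by
  ext b
  rw [Subgroup.mem_pointwise_smul_iff_inv_smul_mem, ← ConjAct.toConjAct_inv, ConjAct.smul_def,
    ConjAct.ofConjAct_toConjAct, inv_inv]
  constructor
  · intro hb
    have hb' := V.mul_mem (V.mul_mem hk hb) (V.inv_mem hk)
    rwa [show k * (k⁻¹ * b * k) * k⁻¹ = b by simp [mul_assoc]] at hb'
  · exact fun hb => V.mul_mem (V.mul_mem (V.inv_mem hk) hb) hk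

variable {G U} in
omit [TopologicalSpace P] in
/-- The branch inclusions of `G_U`: if `γ Π_e γ⁻¹ ⊆ Π_v` in `G` and `x ∈ Π`, then a `U`-conjugate of
`U ∩ x Π_e x⁻¹` lies in `U ∩ y Π_v y⁻¹` for the representative `y` of the double coset
`U x γ⁻¹ Π_v`. [cite: MochizukiCombGC2007, Def 1.1(ii) p.6] -/
theorem exists_conj_subgroupOf_le {E V : Subgroup P} {γ : ConjAct P} (h : γ • E ≤ V) (x : P) :
    ∃ δ : ConjAct U, δ • (ConjAct.toConjAct x • E).subgroupOf U ≤
      (ConjAct.toConjAct (dcRep U V (dcIdx U V (x * (ConjAct.ofConjAct γ)⁻¹))) • V).subgroupOf U := by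
  set y := x * (ConjAct.ofConjAct γ)⁻¹ with hy
  obtain ⟨u, hu, k, hk, hrep⟩ := exists_dcRep_dcIdx_eq U V y
  refine ⟨ConjAct.toConjAct ⟨u, hu⟩, ?_⟩
  rw [conj_subgroupOf_eq, hrep, Subgroup.coe_mk]
  refine Subgroup.comap_mono (f := U.subtype) ?_
  have e1 : ConjAct.toConjAct (u * x) = ConjAct.toConjAct (u * y) * γ := by
    conv_rhs => rw [← ConjAct.toConjAct_ofConjAct γ]
    rw [← map_mul, hy]
    simp [mul_assoc]
  rw [← mul_smul, ← map_mul]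
  calc ConjAct.toConjAct (u * x) • E = ConjAct.toConjAct (u * y) • (γ • E) := by rw [e1, mul_smul]
    _ ≤ ConjAct.toConjAct (u * y) • V := Subgroup.pointwise_smul_le_pointwise_smul_iff.mpr h
    _ = ConjAct.toConjAct (u * y * k) • V := by
        rw [map_mul (ConjAct.toConjAct) (u * y) k, mul_smul, conj_smul_eq_self_of_mem hk]

variable {G U} in
omit [U.FiniteIndex] in
/-- An open subgroup of finite index of a pro-`Σ` group is pro-`Σ` (for the subspace topology): an
open normal subgroup `N` of `U` of finite index contains the normal core of its image in `Π`, an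
open normal subgroup of `Π` of finite index, and `[U : N]` divides its index.
[cite: MochizukiCombGC2007, Def 1.1(ii) p.6] -/
theorem isProSigma_subgroup [IsTopologicalGroup P] {Sigma : Set ℕ} (hP : IsProSigma Sigma P)
    (hU : IsOpen (U : Set P)) (hUf : U.FiniteIndex) : IsProSigma Sigma U := by
  refine ⟨fun N hfin p hp hdvd => ?_⟩
  -- the image `N₁` of `N` in `Π`: open, of finite index
  set N₁ : Subgroup P := N.toSubgroup.map U.subtype with hN₁
  have hN₁o : IsOpen (N₁ : Set P) := by
    have e : (N₁ : Set P) = Subtype.val '' (N : Set U) := by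
      ext x; simp only [hN₁, Subgroup.coe_map, Subgroup.coe_subtype, Set.mem_image, SetLike.mem_coe]; rfl
    rw [e]
    exact hU.isOpenMap_subtype_val _ N.isOpen'
  haveI : N.toSubgroup.FiniteIndex := by
    refine ⟨fun h0 => ?_⟩
    have : Nat.card (U ⧸ N.toSubgroup) = 0 := h0
    exact (Nat.card_pos (α := U ⧸ N.toSubgroup)).ne' this
  haveI : N₁.FiniteIndex := by
    refine ⟨?_⟩
    rw [hN₁, Subgroup.index_map_subtype]
    exact mul_ne_zero Subgroup.FiniteIndex.index_ne_zero hUf.index_ne_zero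
  -- its normal core `M`: an open normal subgroup of `Π` of finite index
  have hMc : IsClosed (N₁.normalCore : Set P) :=
    N₁.normalCore_isClosed (Subgroup.isClosed_of_isOpen N₁ hN₁o)
  have hMo : IsOpen (N₁.normalCore : Set P) := Subgroup.isOpen_of_isClosed_of_finiteIndex _ hMc
  let M : OpenNormalSubgroup P := { toSubgroup := N₁.normalCore, isOpen' := hMo }
  haveI : Finite (P ⧸ M.toSubgroup) := Subgroup.finite_quotient_of_finiteIndex
  refine hP.prime_mem M inferInstance p hp (hdvd.trans ?_)
  calc Nat.card (U ⧸ N.toSubgroup) = N.toSubgroup.index := rfl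
    _ ∣ N₁.index := by rw [hN₁, Subgroup.index_map_subtype]; exact Dvd.intro _ rfl
    _ ∣ N₁.normalCore.index := Subgroup.index_dvd_of_le N₁.normalCore_le
    _ = Nat.card (P ⧸ M.toSubgroup) := rfl

/-! ### Defining equations of the covering graph -/

/-- The cusp `U x Π_c` of `G_U` abuts to the vertex `U x γ_c⁻¹ Π_{v(c)}`. [cite: MochizukiCombGC2007, Def 1.1(ii) p.6] -/
theorem restrictGraph_cuspEnd (d : (G.restrictGraph U).C) :
    (G.restrictGraph U).cuspEnd d =
      G.vertexOver U (G.graph.cuspEnd d.1) (G.crep U d * (ConjAct.ofConjAct (G.cuspConj d.1))⁻¹) :=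
  rfl

/-- The node `U x Π_e` of `G_U` joins `U x γ₁⁻¹ Π_{v₁}` and `U x γ₂⁻¹ Π_{v₂}`. [cite: MochizukiCombGC2007, Def 1.1(ii) p.6] -/
theorem restrictGraph_nodeEnds (d : (G.restrictGraph U).N) :
    (G.restrictGraph U).nodeEnds d =
      s(G.vertexOver U (G.nodeFst d.1) (G.nrep U d * (ConjAct.ofConjAct (G.nodeConjFst d.1))⁻¹),
        G.vertexOver U (G.nodeSnd d.1) (G.nrep U d * (ConjAct.ofConjAct (G.nodeConjSnd d.1))⁻¹)) :=
  rfl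

variable [IsTopologicalGroup P]

/-- **[CombGC] Def. 1.1 (ii): the finite étale `Π_G`-covering `G_U → G`** attached to an open
subgroup `U ⊆ Π_G` of finite index, as a PSC datum with PSC-fundamental group `Π_{G_U} = U`
(underlying semi-graph `restrictGraph`, representative subgroups `U ∩ y Π_v y⁻¹` etc., same `Σ`,
Riemann–Hurwitz genera); "finite index" (automatic for open subgroups of the profinite `Π_G`) is a
separate instance hypothesis so that the datum exists over the bare interface. [cite: MochizukiCombGC2007, Def 1.1(ii) p.6] -/
noncomputable def restrict (hU : IsOpen (U : Set P)) : PSCDatum U where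
  Sigma := G.Sigma
  sigma_prime := G.sigma_prime
  sigma_nonempty := G.sigma_nonempty
  graph := G.restrictGraph U
  vertGp := G.restrictVertGp U
  nodeGp := G.restrictNodeGp U
  cuspGp := G.restrictCuspGp U
  genus := G.restrictGenus U
  isClosed_vertGp w := isClosed_subgroupOf (isClosed_conj (G.isClosed_vertGp w.1) _)
  isClosed_nodeGp d := isClosed_subgroupOf (isClosed_conj (G.isClosed_nodeGp d.1) _)
  isClosed_cuspGp d := isClosed_subgroupOf (isClosed_conj (G.isClosed_cuspGp d.1) _)
  nodeGp_le d := ⟨_, _, rfl, exists_conj_subgroupOf_le (G.nodeConjFst_smul_le d.1) _,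
    exists_conj_subgroupOf_le (G.nodeConjSnd_smul_le d.1) _⟩
  cuspGp_le d := exists_conj_subgroupOf_le (G.cuspConj_smul_le d.1) _
  proSigma := isProSigma_subgroup G.proSigma hU inferInstance

/-! ### Defining equations of `restrict` -/

variable (hU : IsOpen (U : Set P))

/-- `G_U` has the same `Σ`. [cite: MochizukiCombGC2007, Def 1.1(ii) p.6] -/
@[simp] theorem restrict_Sigma : (G.restrict U hU).Sigma = G.Sigma := rfl

/-- The underlying semi-graph of `G_U` is `restrictGraph`. [cite: MochizukiCombGC2007, Def 1.1(ii) p.6] -/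
@[simp] theorem restrict_graph : (G.restrict U hU).graph = G.restrictGraph U := rfl

/-- `Π_w = U ∩ y_w Π_v y_w⁻¹`. [cite: MochizukiCombGC2007, Def 1.1(ii) p.6] -/
theorem restrict_vertGp (w : (G.restrictGraph U).V) :
    (G.restrict U hU).vertGp w = (ConjAct.toConjAct (G.vrep U w) • G.vertGp w.1).subgroupOf U := rfl

/-- `Π_{(e,i)} = U ∩ x Π_e x⁻¹`. [cite: MochizukiCombGC2007, Def 1.1(ii) p.7] -/
theorem restrict_nodeGp (d : (G.restrictGraph U).N) :
    (G.restrict U hU).nodeGp d = (ConjAct.toConjAct (G.nrep U d) • G.nodeGp d.1).subgroupOf U := rfl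

/-- `Π_{(c,i)} = U ∩ x Π_c x⁻¹`. [cite: MochizukiCombGC2007, Def 1.1(ii) p.7] -/
theorem restrict_cuspGp (d : (G.restrictGraph U).C) :
    (G.restrict U hU).cuspGp d = (ConjAct.toConjAct (G.crep U d) • G.cuspGp d.1).subgroupOf U := rfl

end Restrict

end PSCDatum

end Literature.AnabelianGeometry.SemiGraphs
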